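import Summits.HodgeConjecture.HodgeConjecture.Cruxes.BlochSeedDiscOne.DepthBoundA4

/-!
# B3ChainIsolation — LAW QI: the monad equation `q ∘ i = 0` read at SECTION level (hsemireg-monad-4 g29)

D-0145 token: line `stmt-HodgeConjecture-18881` `Cruxes/BlochSeedDiscOne/Lines/birth.lean` 814a6a70c14e831a
`stub_rung_pad4_seedAt` — the registered stub is UNTOUCHED.  CENSUS-NEUTRAL typed evidence in the (B3)∕(α′) lane
(cohomology of a three-term monad `0 → A —i→ N —q→ C → 0` of box line bundles on `X = (E_i × E_{−i})⁴`).
Nothing in this file is a theorem about sheaves: it is exact-integer ∕ matrix bookkeeping on LETTER DESIGNS plus one-line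
matrix identities.  Designs ≠ displays ≠ sheaves ≠ SEED; nothing here is proved toward HC ∕ HC_CM ∕ HC_AV ∕ №4 ∕ 26512 ∕
18881 ∕ (H2).

Companion memo `Cruxes/BlochSeedDiscOne/B3FLAT-QILAW-monad4-g29.md`; engine `qilaw.py` (monad-4 g29).
Import note: only `DepthBoundA4` (`Letter`, `Cell`, `NotDead`, `WeakLive`) is imported; the g28 door vocabulary
(`KunnethDegree.Channel ∕ Supplies ∕ Detects ∕ Design3 ∕ RuleKD`, file `B3KunnethDegree.lean`) is NOT restated here — §C is
written PARAMETRICALLY in the channel ∕ supplier ∕ detection predicates, and instantiating it with g28's gives RULE KD♯ and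
`RULE KD♯ ⇒ RULE KD` by `doorKD_of_doorKDSharp` (definitional unfolding; the g28 module was not yet built on the farm when
this file was checked, hence the parametric form).

## The law (pen, memo §1–§3; every Pic⁰ key open = upper bound on every Hom)

Components in section bases: `i_{a→ν} = Σ_u s_u ⊗ B_u` (`s_u` a basis of `H⁰(L_ν ⊗ L_a^{-1})`, `B_u ∈ Mat(m_ν × m_a)`),
`q_{ν→c} = Σ_t σ_t ⊗ Q_t`.  The `(c,a)` component of `q ∘ i = 0` reads `Σ_{ν ∈ Ch(a,c)} Σ_{t,u} (σ_t · s_u) ⊗ (Q_t B_u) = 0`.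
* LAW QI-1 (THIN ISOLATED CHAINS).  If `ν` is the ONLY supported N-cell weakly between `a` and `c` (`IsolatedIn`) and on
  every factor one of the two steps has a one-dimensional `H⁰` (`Thin`: the section product map is `⊗_f μ_f`, each `μ_f` =
  multiplication by one non-zero section of a line bundle on an integral surface, hence injective), then `Q_t B_u = 0 ∀ t, u`.
* LAW QI-2 (KEYED CHANNEL LAW ⇒ RULE KD♯).  The `d₂`-channel of LAW KD (monad-4 g28 + UNIT LAW) carried by
  `η ∈ Ext³(L_c, L_a) ⊗ Hom` along `a → ν → c` has matrix part `H·Q·B` at the A-reading, `Q·B·H` at the C-reading, `B·H·Q` at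
  the N-reading (`readingA_eq_zero`, `readingC_eq_zero`, `readingN_trace_eq_zero`): on a thin isolated chain it is ZERO at `a`, `c`
  and TRACELESS at `ν`, so it cannot hit the diagonal target `ξ̄ ⊗ Id` (`ne_smul_one_of_trace_eq_zero`).  Hence the door with
  ♯-channels (`DoorKDSharp`: channels along thin isolated chains do not count) is still necessary for (H2), and it implies the
  g28 door (`doorKD_of_doorKDSharp`): CLOSED₂₈ ⊆ CLOSED♯ blockwise.
* LAW QI-3 (FORCED-ZERO PROPAGATION).  A clean♯ detecting block with exactly one live supplier `y`, `h⁰(step) = 1`, `m_y = LHS`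
  forces its component to be `s ⊗ B`, `B` INVERTIBLE (`isUnit_of_smul_one_left_inverse`; monad-2 g8 §4.2 re-derived); on a thin
  isolated chain through it the other component VANISHES (`eq_zero_of_mul_isUnit_eq_zero`, `eq_zero_of_isUnit_mul_eq_zero`), the
  arrow is dead, and suppliers ∕ channels ∕ chains are recomputed (engine fixpoint).

Engine record (37 designs of record, `qilaw-TABLE.md`): KD♯ closes strictly more blocks than KD on S84 ×2 (48 → 240 ∕ 336),
JOINT-LP (1368 → 1848), WNSH2L ×2 (576 → 672), M1 (minimal 2520 → 2616); propagation kills 48–8512 arrows on 12 designs and makes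
Hall_q fail on M72 ×2 and №53 ×3 (all already dead at (H2)); S131 ×3 stay UNDECIDED (1600 ∕ 1600 ∕ 832 thin isolated chains, none
channel-carrying in the strict reading; 48 identical-atom q-arrows die; Hall and coupled Hall pass with slack 4) — also with
monad-2 g8's 672 UNIT-law forced components injected.

No `sorry`, no `axiom`, no `instance`, no `notation`, no `native_decide`.
-/

set_option linter.dupNamespace false
set_option autoImplicit false

namespace Summit.HodgeConjecture.HodgeConjecture.Cruxes.BlochSeedDiscOne.ChainIsolation

open DepthBoundA4

/-! ## §A  The matrix core of RULE KD♯ and of the propagation (three readings of one channel) -/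

section MatrixCore

variable {R : Type*} [CommRing R] {ιa ιν ιc : Type*}

/-- A-reading `(a,a)` of the channel: matrix part `H · Q · B`; it vanishes when `Q · B = 0` (thin isolated chain). -/
theorem readingA_eq_zero [Fintype ιν] [Fintype ιc] (H : Matrix ιa ιc R) (Q : Matrix ιc ιν R) (B : Matrix ιν ιa R)
    (h : Q * B = 0) : H * Q * B = 0 := by
  rw [Matrix.mul_assoc, h, Matrix.mul_zero]

/-- C-reading `(c,c)` of the channel: matrix part `Q · B · H`; it vanishes when `Q · B = 0`. -/
theorem readingC_eq_zero [Fintype ιa] [Fintype ιν] (H : Matrix ιa ιc R) (Q : Matrix ιc ιν R) (B : Matrix ιν ιa R)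
    (h : Q * B = 0) : Q * B * H = 0 := by
  rw [h, Matrix.zero_mul]

/-- N-reading `(ν,ν)` of the channel: matrix part `B · H · Q`; it is TRACELESS when `Q · B = 0`. -/
theorem readingN_trace_eq_zero [Fintype ιa] [Fintype ιν] [Fintype ιc] (H : Matrix ιa ιc R) (Q : Matrix ιc ιν R)
    (B : Matrix ιν ιa R) (h : Q * B = 0) : Matrix.trace (B * H * Q) = 0 := by
  rw [Matrix.trace_mul_cycle, h, Matrix.zero_mul, Matrix.trace_zero]

/-- The N-reading consequence spelled out: a traceless matrix is not `r • 1` when `r · |ι| ≠ 0` (the diagonal target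
`ξ̄ ⊗ Id_m` has trace `m · ξ̄ ≠ 0` in characteristic `0`). -/
theorem ne_smul_one_of_trace_eq_zero [Fintype ιν] [DecidableEq ιν] (M : Matrix ιν ιν R) (r : R)
    (hM : Matrix.trace M = 0) (hr : r * (Fintype.card ιν : R) ≠ 0) : M ≠ r • (1 : Matrix ιν ιν R) := by
  intro hEq
  apply hr
  have h := hM
  rw [hEq, Matrix.trace_smul, Matrix.trace_one, smul_eq_mul] at h
  exact h

/-- PROPAGATION, `i`-side forced: `Q · B = 0` with `B` invertible forces `Q = 0` (the q-arrow `ν → c` is dead). -/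
theorem eq_zero_of_mul_isUnit_eq_zero [Fintype ιν] [DecidableEq ιν] (Q : Matrix ιc ιν R) (B : Matrix ιν ιν R)
    (hB : IsUnit B) (h : Q * B = 0) : Q = 0 := by
  obtain ⟨u, rfl⟩ := hB
  have h' : Q * ((u : Matrix ιν ιν R) * ((u⁻¹ : (Matrix ιν ιν R)ˣ) : Matrix ιν ιν R)) = 0 := by
    rw [← Matrix.mul_assoc, h, Matrix.zero_mul]
  rwa [Units.mul_inv, Matrix.mul_one] at h'

/-- PROPAGATION, `q`-side forced: `Q · B = 0` with `Q` invertible forces `B = 0` (the i-arrow `a → ν` is dead). -/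
theorem eq_zero_of_isUnit_mul_eq_zero [Fintype ιν] [DecidableEq ιν] (Q : Matrix ιν ιν R) (B : Matrix ιν ιa R)
    (hQ : IsUnit Q) (h : Q * B = 0) : B = 0 := by
  obtain ⟨u, rfl⟩ := hQ
  have h' : (((u⁻¹ : (Matrix ιν ιν R)ˣ) : Matrix ιν ιν R) * (u : Matrix ιν ιν R)) * B = 0 := by
    rw [Matrix.mul_assoc, h, Matrix.mul_zero]
  rwa [Units.inv_mul, Matrix.one_mul] at h'

/-- Both components of one thin isolated chain cannot be forced invertible (engine: «doubly-forced chain» = contradiction). -/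
theorem not_isUnit_and_isUnit_of_mul_eq_zero [Fintype ιν] [DecidableEq ιν] [Nonempty ιν] [Nontrivial R]
    (Q B : Matrix ιν ιν R) (h : Q * B = 0) : ¬ (IsUnit Q ∧ IsUnit B) := by
  rintro ⟨hQ, hB⟩
  have hB0 : B = 0 := eq_zero_of_isUnit_mul_eq_zero Q B hQ h
  rw [hB0] at hB
  exact not_isUnit_zero hB

end MatrixCore

section Field

variable {K : Type*} [Field K] {ι : Type*} [Fintype ι] [DecidableEq ι]

/-- FORCED INVERTIBILITY (monad-2 g8 §4.2, re-derived in memo §3): the single-supplier tight block equation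
`H′ · B = m · Id` with `m ≠ 0` and square `B` makes `B` a unit. -/
theorem isUnit_of_smul_one_left_inverse (H B : Matrix ι ι K) (m : K) (hm : m ≠ 0)
    (h : H * B = m • (1 : Matrix ι ι K)) : IsUnit B := by
  have hl : (m⁻¹ • H) * B = 1 := by
    rw [Matrix.smul_mul, h, smul_smul, inv_mul_cancel₀ hm, one_smul]
  have hr : B * (m⁻¹ • H) = 1 := mul_eq_one_comm.mp hl
  exact ⟨⟨B, m⁻¹ • H, hr, hl⟩, rfl⟩

end Field

/-! ## §B  Letter level: `h⁰` of a step, THIN chains -/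

/-- `h⁰(Hom(L_ℓ, L_ℓ′))` on one factor `E_i × E_{−i}` with the Pic⁰ key open (Mumford index theorem + Künneth; tree
`SigmaH`, `B3MonadCohomology`): EQUAL `1`; dead `0`; NULL-up = content `gcd(Δa, Δx, Δy)` (the upper bound over keys);
AMPLE-up `χ = Δa² − Δx² − Δy²`. -/
def h0step (ℓ ℓ' : Letter) : ℕ :=
  if ℓ = ℓ' then 1 else
    let da := ℓ'.a - ℓ.a
    let dx := ℓ'.x - ℓ.x
    let dy := ℓ'.y - ℓ.y
    let n := da ^ 2 - dx ^ 2 - dy ^ 2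
    if da ≤ 0 then 0 else if n < 0 then 0 else if n = 0 then Nat.gcd (Int.gcd da dx) dy.natAbs else n.toNat

/-- THIN chain `a → ν → c`: on every factor one of the two steps has `h⁰ = 1` (so the section product map is injective). -/
def Thin (a ν c : Cell) : Prop := ∀ f : Fin 4, min (h0step (a f) (ν f)) (h0step (ν f) (c f)) = 1

/-- `h⁰ = 1` steps: EQUAL, and primitive NULL steps such as `(13;−3,0) → (14;−2,0)` and `(15;−1,0) → (16;0,0)` (S131);
NULL steps of higher content: `(12;−4,0) → (14;−2,0)` (2), `(12;−4,0) → (16;0,0)` (4), `(10;−6,0) → (16;0,0)` (6); a genuinely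
AMPLE step `(12;−2,0) → (16;0,0)` has `h⁰ = 16 − 4 = 12`; downward steps are dead. -/
example : h0step ⟨13, -3, 0⟩ ⟨14, -2, 0⟩ = 1 ∧ h0step ⟨15, -1, 0⟩ ⟨16, 0, 0⟩ = 1 ∧ h0step ⟨12, -4, 0⟩ ⟨14, -2, 0⟩ = 2 ∧
    h0step ⟨12, -4, 0⟩ ⟨16, 0, 0⟩ = 4 ∧ h0step ⟨10, -6, 0⟩ ⟨16, 0, 0⟩ = 6 ∧ h0step ⟨12, -2, 0⟩ ⟨16, 0, 0⟩ = 12 ∧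
    h0step ⟨16, 0, 0⟩ ⟨16, 0, 0⟩ = 1 ∧ h0step ⟨16, 0, 0⟩ ⟨15, -1, 0⟩ = 0 := by
  decide +kernel

/-! ## §C  Design level, parametric in the door vocabulary: ISOLATED pairs, ♯-channels, the door and its monotonicity -/

/-- `(a, c)` is ISOLATED w.r.t. the supported N-cells `Ns`: at most one of them is weakly between `a` and `c`
(then `(q ∘ i)_{ca}` has ONE term). -/
def IsolatedIn (Ns : List Cell) (a c : Cell) : Prop :=
  ∀ ν₁ ∈ Ns, ∀ ν₂ ∈ Ns, WeakLive a ν₁ → WeakLive ν₁ c → WeakLive a ν₂ → WeakLive ν₂ c → ν₁ = ν₂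

/-- The channel predicate that SURVIVES LAW QI-2: a channel (`Ch`, e.g. g28's `KunnethDegree.Channel`) NOT running along a thin
isolated chain. -/
def SharpOf (Ns : List Cell) (Ch : Cell → Cell → Cell → Fin 4 → Fin 4 → Prop) :
    Cell → Cell → Cell → Fin 4 → Fin 4 → Prop :=
  fun a ν c g j => Ch a ν c g j ∧ ¬ (Thin a ν c ∧ IsolatedIn Ns a c)

theorem sharpOf_imp (Ns : List Cell) (Ch : Cell → Cell → Cell → Fin 4 → Fin 4 → Prop) (a ν c : Cell) (g j : Fin 4)
    (h : SharpOf Ns Ch a ν c g j) : Ch a ν c g j := h.1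

/-- Chain escapes of the three readings built from a channel predicate `Ch` (g28's `EscA ∕ EscN ∕ EscC` for `Ch = Channel`). -/
def EscAOf (Ns Cs : List Cell) (Ch : Cell → Cell → Cell → Fin 4 → Fin 4 → Prop) (a : Cell) (g j : Fin 4) : Prop :=
  ∃ ν ∈ Ns, ∃ c ∈ Cs, WeakLive a ν ∧ WeakLive ν c ∧ Ch a ν c g j
/-- N-reading escape. -/
def EscNOf (As Cs : List Cell) (Ch : Cell → Cell → Cell → Fin 4 → Fin 4 → Prop) (ν : Cell) (g j : Fin 4) : Prop :=
  ∃ a ∈ As, ∃ c ∈ Cs, WeakLive a ν ∧ WeakLive ν c ∧ Ch a ν c g j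
/-- C-reading escape. -/
def EscCOf (As Ns : List Cell) (Ch : Cell → Cell → Cell → Fin 4 → Fin 4 → Prop) (c : Cell) (g j : Fin 4) : Prop :=
  ∃ a ∈ As, ∃ ν ∈ Ns, WeakLive a ν ∧ WeakLive ν c ∧ Ch a ν c g j

theorem escAOf_mono {Ns Cs : List Cell} {Ch₁ Ch₂ : Cell → Cell → Cell → Fin 4 → Fin 4 → Prop}
    (hCh : ∀ a ν c g j, Ch₁ a ν c g j → Ch₂ a ν c g j) (a : Cell) (g j : Fin 4) (h : EscAOf Ns Cs Ch₁ a g j) :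
    EscAOf Ns Cs Ch₂ a g j := by
  obtain ⟨ν, hν, c, hc, h1, h2, h3⟩ := h
  exact ⟨ν, hν, c, hc, h1, h2, hCh _ _ _ _ _ h3⟩

theorem escNOf_mono {As Cs : List Cell} {Ch₁ Ch₂ : Cell → Cell → Cell → Fin 4 → Fin 4 → Prop}
    (hCh : ∀ a ν c g j, Ch₁ a ν c g j → Ch₂ a ν c g j) (ν : Cell) (g j : Fin 4) (h : EscNOf As Cs Ch₁ ν g j) :
    EscNOf As Cs Ch₂ ν g j := by
  obtain ⟨a, ha, c, hc, h1, h2, h3⟩ := h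
  exact ⟨a, ha, c, hc, h1, h2, hCh _ _ _ _ _ h3⟩

theorem escCOf_mono {As Ns : List Cell} {Ch₁ Ch₂ : Cell → Cell → Cell → Fin 4 → Fin 4 → Prop}
    (hCh : ∀ a ν c g j, Ch₁ a ν c g j → Ch₂ a ν c g j) (c : Cell) (g j : Fin 4) (h : EscCOf As Ns Ch₁ c g j) :
    EscCOf As Ns Ch₂ c g j := by
  obtain ⟨a, ha, ν, hν, h1, h2, h3⟩ := h
  exact ⟨a, ha, ν, hν, h1, h2, hCh _ _ _ _ _ h3⟩

/-- The three-clause diagonal door, parametric in the detection predicate `Det`, the supplier predicate `Sup` (read `Sup x y g j`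
with `y` weakly ABOVE `x`) and the channel predicate `Ch`.  With `As ∕ Ns ∕ Cs := D.suppA ∕ D.suppN ∕ D.suppC`,
`Det := KunnethDegree.Detects`, `Sup := KunnethDegree.Supplies` (resp. `SuppliesStrict` for minimal displays) and
`Ch := KunnethDegree.Channel` this is g28's `RuleKD D` (resp. `RuleKDmin D`) clause by clause. -/
def DoorKD (As Ns Cs : List Cell) (Det : Cell → Fin 4 → Fin 4 → Prop) (Sup : Cell → Cell → Fin 4 → Fin 4 → Prop)
    (Ch : Cell → Cell → Cell → Fin 4 → Fin 4 → Prop) : Prop :=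
  (∀ a ∈ As, ∀ g j : Fin 4, g < j → Det a g j → (∃ n ∈ Ns, Sup a n g j) ∨ EscAOf Ns Cs Ch a g j) ∧
  (∀ n ∈ Ns, ∀ g j : Fin 4, g < j → Det n g j →
      (∃ a ∈ As, Sup a n g j) ∨ (∃ c ∈ Cs, Sup n c g j) ∨ EscNOf As Cs Ch n g j) ∧
  (∀ c ∈ Cs, ∀ g j : Fin 4, g < j → Det c g j → (∃ n ∈ Ns, Sup n c g j) ∨ EscCOf As Ns Ch c g j)

/-- RULE KD♯ — THE DOOR OF THIS MEMO: the same door with ♯-channels only.  LAW (pen, memo §2): for every holomorphic three-term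
box-line-bundle monad on `E⁴` realising the design, door (H2) ⇒ `DoorKDSharp` (any Pic⁰ labelling, any maps); a violated clause
names a CLOSED♯ block and a `κ ∈ T_W` with `ob_κ(𝓔) ≠ 0`. -/
def DoorKDSharp (As Ns Cs : List Cell) (Det : Cell → Fin 4 → Fin 4 → Prop) (Sup : Cell → Cell → Fin 4 → Fin 4 → Prop)
    (Ch : Cell → Cell → Cell → Fin 4 → Fin 4 → Prop) : Prop :=
  DoorKD As Ns Cs Det Sup (SharpOf Ns Ch)

/-- Monotonicity of the door in the channel predicate. -/
theorem doorKD_mono (As Ns Cs : List Cell) (Det : Cell → Fin 4 → Fin 4 → Prop) (Sup : Cell → Cell → Fin 4 → Fin 4 → Prop)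
    {Ch₁ Ch₂ : Cell → Cell → Cell → Fin 4 → Fin 4 → Prop} (hCh : ∀ a ν c g j, Ch₁ a ν c g j → Ch₂ a ν c g j)
    (h : DoorKD As Ns Cs Det Sup Ch₁) : DoorKD As Ns Cs Det Sup Ch₂ := by
  obtain ⟨hA, hN, hC⟩ := h
  refine ⟨?_, ?_, ?_⟩
  · intro a ha g j hgj hd
    rcases hA a ha g j hgj hd with hs | he
    · exact Or.inl hs
    · exact Or.inr (escAOf_mono hCh a g j he)
  · intro n hn g j hgj hd
    rcases hN n hn g j hgj hd with hs | hs | he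
    · exact Or.inl hs
    · exact Or.inr (Or.inl hs)
    · exact Or.inr (Or.inr (escNOf_mono hCh n g j he))
  · intro c hc g j hgj hd
    rcases hC c hc g j hgj hd with hs | he
    · exact Or.inl hs
    · exact Or.inr (escCOf_mono hCh c g j he)

/-- CLOSED₂₈ ⊆ CLOSED♯ (engine columns `c28 ≤ c29`): RULE KD♯ ⇒ RULE KD. -/
theorem doorKD_of_doorKDSharp (As Ns Cs : List Cell) (Det : Cell → Fin 4 → Fin 4 → Prop)
    (Sup : Cell → Cell → Fin 4 → Fin 4 → Prop) (Ch : Cell → Cell → Cell → Fin 4 → Fin 4 → Prop)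
    (h : DoorKDSharp As Ns Cs Det Sup Ch) : DoorKD As Ns Cs Det Sup Ch :=
  doorKD_mono As Ns Cs Det Sup (fun a ν c g j hs => sharpOf_imp Ns Ch a ν c g j hs) h

/-- RULE D₃ (no channel at all, `Ch := ⊥`) ⇒ RULE KD♯: the `d₁`-only door is the strongest of the family. -/
theorem doorKDSharp_of_doorD3 (As Ns Cs : List Cell) (Det : Cell → Fin 4 → Fin 4 → Prop)
    (Sup : Cell → Cell → Fin 4 → Fin 4 → Prop) (Ch : Cell → Cell → Cell → Fin 4 → Fin 4 → Prop)
    (h : DoorKD As Ns Cs Det Sup (fun _ _ _ _ _ => False)) : DoorKDSharp As Ns Cs Det Sup Ch :=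
  doorKD_mono As Ns Cs Det Sup (fun _ _ _ _ _ hf => hf.elim) h

/-- Minimal-display rider: a stricter supplier predicate (`Sup₁ ⇒ Sup₂`, e.g. `SuppliesStrict ⇒ Supplies`) gives a stronger door. -/
theorem doorKD_mono_sup (As Ns Cs : List Cell) (Det : Cell → Fin 4 → Fin 4 → Prop)
    {Sup₁ Sup₂ : Cell → Cell → Fin 4 → Fin 4 → Prop} (hS : ∀ x y g j, Sup₁ x y g j → Sup₂ x y g j)
    (Ch : Cell → Cell → Cell → Fin 4 → Fin 4 → Prop) (h : DoorKD As Ns Cs Det Sup₁ Ch) : DoorKD As Ns Cs Det Sup₂ Ch := by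
  obtain ⟨hA, hN, hC⟩ := h
  refine ⟨?_, ?_, ?_⟩
  · intro a ha g j hgj hd
    rcases hA a ha g j hgj hd with ⟨n, hn, hs⟩ | he
    · exact Or.inl ⟨n, hn, hS _ _ _ _ hs⟩
    · exact Or.inr he
  · intro n hn g j hgj hd
    rcases hN n hn g j hgj hd with ⟨a, ha, hs⟩ | ⟨c, hc, hs⟩ | he
    · exact Or.inl ⟨a, ha, hS _ _ _ _ hs⟩
    · exact Or.inr (Or.inl ⟨c, hc, hS _ _ _ _ hs⟩)
    · exact Or.inr (Or.inr he)
  · intro c hc g j hgj hd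
    rcases hC c hc g j hgj hd with ⟨n, hn, hs⟩ | he
    · exact Or.inl ⟨n, hn, hS _ _ _ _ hs⟩
    · exact Or.inr he

/-- Two-term designs (`Cs = []`): no chain, every door of the family coincides with the `d₁`-only door. -/
theorem doorKD_iff_of_C_nil (As Ns : List Cell) (Det : Cell → Fin 4 → Fin 4 → Prop)
    (Sup : Cell → Cell → Fin 4 → Fin 4 → Prop) (Ch : Cell → Cell → Cell → Fin 4 → Fin 4 → Prop) :
    DoorKD As Ns [] Det Sup Ch ↔ DoorKD As Ns [] Det Sup (fun _ _ _ _ _ => False) := by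
  constructor
  · rintro ⟨hA, hN, -⟩
    refine ⟨?_, ?_, ?_⟩
    · intro a ha g j hgj hd
      rcases hA a ha g j hgj hd with hs | ⟨ν, _, c, hc, _⟩
      · exact Or.inl hs
      · simp at hc
    · intro n hn g j hgj hd
      rcases hN n hn g j hgj hd with hs | hs | ⟨a, _, c, hc, _⟩
      · exact Or.inl hs
      · exact Or.inr (Or.inl hs)
      · simp at hc
    · intro c hc
      simp at hc
  · exact doorKD_mono As Ns [] Det Sup (fun _ _ _ _ _ hf => hf.elim)

/-! ## §D  Decidable instances from the engine logs -/

section checks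

/-- S131 NOHUB bf2edc09, A-cell of the KD♯-only forced component of memo §5. -/
def s131a : Cell := ![⟨12, -4, 0⟩, ⟨15, -1, 0⟩, ⟨15, -1, 0⟩, ⟨16, 0, 0⟩]
/-- … the middle N-cell of its channel-carrying chain. -/
def s131n : Cell := ![⟨14, -2, 0⟩, ⟨15, -1, 0⟩, ⟨15, -1, 0⟩, ⟨16, 0, 0⟩]
/-- … a second candidate middle (present in the design as an A- and C-cell, NOT as an N-cell between them: engine). -/
def s131n' : Cell := ![⟨13, -3, 0⟩, ⟨15, -1, 0⟩, ⟨15, -1, 0⟩, ⟨16, 0, 0⟩]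
/-- … the C-cell at the top of the chain. -/
def s131c : Cell := ![⟨15, -1, 0⟩, ⟨15, -1, 0⟩, ⟨15, -1, 0⟩, ⟨16, 0, 0⟩]

/-- The chain `s131a → s131n → s131c` is THIN (every step EQUAL or a primitive NULL step) and weakly live; in the design it
is isolated (engine), and g28's `Channel` holds on all six blocks (engine PAT28), so under LAW QI those channels are dead and
the single-supplier blocks `(1,3)`, `(2,3)` of `s131a` are forced invertible (memo §5). -/
example : Thin s131a s131n s131c ∧ WeakLive s131a s131n ∧ WeakLive s131n s131c := by
  unfold Thin WeakLive NotDead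
  decide

set_option synthInstance.maxSize 4096 in
set_option synthInstance.maxHeartbeats 200000 in
/-- Isolation is a property of the N-support: with both candidate middles present the pair is NOT isolated; with one it is.
(The decidability instance of the unfolded statement is large; the size bound is raised for this check only.) -/
example : IsolatedIn [s131n] s131a s131c ∧ ¬ IsolatedIn [s131n, s131n'] s131a s131c := by
  unfold IsolatedIn WeakLive NotDead
  decide

/-- S84 ac808a66 (strict reading), the first propagation kill of the log: A-cell and its single supplier. -/
def s84a : Cell := ![⟨11, 0, 3⟩, ⟨13, -1, 0⟩, ⟨14, 0, 0⟩, ⟨12, 0, 2⟩]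
/-- … the N-cell (also a C-cell of the design: identical atom). -/
def s84n : Cell := ![⟨11, 0, 3⟩, ⟨14, 0, 0⟩, ⟨14, 0, 0⟩, ⟨12, 0, 2⟩]

/-- `s84a → s84n` is a primitive NULL step on factor 1 (`h⁰ = 1`), and the chain `s84a → s84n → s84n` (identical C-atom) is
THIN; the engine finds it isolated and the block clean♯ with `s84n` the only supplier of equal mass, so the identical-atom
component `q_{ν→ν}` is ZERO — the WLOG of the minimal display, here DERIVED. -/
example : h0step (s84a 1) (s84n 1) = 1 ∧ Thin s84a s84n s84n ∧ WeakLive s84a s84n := by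
  unfold Thin WeakLive NotDead
  decide

/-- A NON-thin chain (LAW QI-1 is silent on it even if isolated): `(12;−4,0) → (14;−2,0) → (16;0,0)` on factor 0 has both
steps of content 2. -/
example : ¬ Thin ![⟨12, -4, 0⟩, ⟨16, 0, 0⟩, ⟨16, 0, 0⟩, ⟨16, 0, 0⟩] ![⟨14, -2, 0⟩, ⟨16, 0, 0⟩, ⟨16, 0, 0⟩, ⟨16, 0, 0⟩]
    ![⟨16, 0, 0⟩, ⟨16, 0, 0⟩, ⟨16, 0, 0⟩, ⟨16, 0, 0⟩] := by
  unfold Thin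
  decide

end checks

end Summit.HodgeConjecture.HodgeConjecture.Cruxes.BlochSeedDiscOne.ChainIsolation
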